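import Summits.Ventures.PercRepro.SixThreePlane

/-!
# PercRepro — the demand side of the planar inequalities `(I_t)` (p2, gen 6)

mine-2 `MINE2-RLS.md` §19.6: on a plane `G` of type `t = 6 − ρ(E ∖ G) ≥ 1` not every rank-`3` subset of `G` is a
bottom set.  With `N₃(G) = #{B ⊆ G : ρ(B) = 3}`:
* `t ≥ 1` (`ρ(E ∖ G) ≤ 5`): `G ∉ U_G`, so `#U_G + 1 ≤ N₃(G)`;
* `t ≥ 2` (`ρ(E ∖ G) ≤ 4`): also `G ∖ {a} ∉ U_G` for every `a`, so `#U_G + 1 + g′ ≤ N₃(G)`,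
  `g′ = #{a ∈ G : ρ(G ∖ {a}) = 3}`.
-/

namespace PercRepro

namespace SixThree

open Finset ThmH PerFlat

variable {α : Type*} [DecidableEq α] {M : Matroid α} [M.Finite]

/-- `U_G ⊆ R₃(G)`. -/
theorem UqG_subset_R3 (G : Finset α) : UqG M 6 3 G ⊆ R3 M G := by
  intro B hB
  obtain ⟨⟨-, hrB, -⟩, hBG⟩ := mem_UqG_six_three.1 hB
  unfold R3
  rw [Finset.mem_filter, Finset.mem_powerset]
  exact ⟨hBG, hrB⟩

omit [DecidableEq α] in
/-- `G ∈ R₃(G)` for a plane `G`. -/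
theorem self_mem_R3 {G : Finset α} (hG : G ∈ planes M) : G ∈ R3 M G := by
  unfold R3
  rw [Finset.mem_filter, Finset.mem_powerset]
  exact ⟨Finset.Subset.refl _, (mem_planes.1 hG).2.2⟩

/-- A plane with `ρ(E ∖ G) ≤ 5` is not a bottom set. -/
theorem self_notMem_UqG {G : Finset α}
    (hr : M.eRk ((gr M \ G : Finset α) : Set α) ≤ 5) : G ∉ UqG M 6 3 G := by
  intro h
  obtain ⟨⟨-, -, h6⟩, -⟩ := mem_UqG_six_three.1 h
  rw [h6] at hr
  exact absurd hr (by decide)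

/-- **Demand at type `≥ 1`**: `#U_G + 1 ≤ N₃(G)`. -/
theorem card_UqG_add_one_le {G : Finset α} (hG : G ∈ planes M)
    (hr : M.eRk ((gr M \ G : Finset α) : Set α) ≤ 5) : (UqG M 6 3 G).card + 1 ≤ (R3 M G).card := by
  have hsub : insert G (UqG M 6 3 G) ⊆ R3 M G :=
    Finset.insert_subset (self_mem_R3 hG) (UqG_subset_R3 G)
  have := Finset.card_le_card hsub
  rw [Finset.card_insert_of_notMem (self_notMem_UqG hr)] at this
  exact this

/-- When `ρ(E ∖ G) ≤ 4`, removing one point of `G` leaves a complement of rank `≤ 5`: `G ∖ {a} ∉ U_G`. -/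
theorem erase_notMem_UqG {G : Finset α}
    (hr : M.eRk ((gr M \ G : Finset α) : Set α) ≤ 4) (a : α) : G.erase a ∉ UqG M 6 3 G := by
  intro h
  obtain ⟨⟨-, -, h6⟩, -⟩ := mem_UqG_six_three.1 h
  have hsub : gr M \ G.erase a ⊆ insert a (gr M \ G) := by
    intro y hy
    rw [Finset.mem_sdiff, Finset.mem_erase] at hy
    rw [Finset.mem_insert, Finset.mem_sdiff]
    by_cases hya : y = a
    · exact Or.inl hya
    · exact Or.inr ⟨hy.1, fun hyG => hy.2 ⟨hya, hyG⟩⟩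
  have h1 : M.eRk ((gr M \ G.erase a : Finset α) : Set α) ≤
      M.eRk ((insert a (gr M \ G) : Finset α) : Set α) := M.eRk_mono (Finset.coe_subset.2 hsub)
  have h2 := eRk_insert_le_add_one (M := M) (gr M \ G) a
  rw [h6] at h1
  have h3 : (6 : ℕ∞) ≤ 4 + 1 := h1.trans (h2.trans (add_le_add hr (le_refl _)))
  exact absurd h3 (by decide)

/-- **Demand at type `≥ 2`**: `#U_G + 1 + g′ ≤ N₃(G)`, `g′ = #{a ∈ G : ρ(G ∖ {a}) = 3}`. -/
theorem card_UqG_add_gprime_le {G : Finset α} (hG : G ∈ planes M)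
    (hr : M.eRk ((gr M \ G : Finset α) : Set α) ≤ 4) :
    (UqG M 6 3 G).card + 1 + (G.filter (fun a => M.eRk ((G.erase a : Finset α) : Set α) = 3)).card ≤
      (R3 M G).card := by
  classical
  set Ex := (G.filter (fun a => M.eRk ((G.erase a : Finset α) : Set α) = 3)).image (fun a => G.erase a) with hEx
  have hExcard : Ex.card = (G.filter (fun a => M.eRk ((G.erase a : Finset α) : Set α) = 3)).card := by
    rw [hEx]
    apply Finset.card_image_of_injOn
    intro a ha b hb hab
    simp only at hab
    have haG : a ∈ G := (Finset.mem_filter.1 ha).1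
    have hbG : b ∈ G := (Finset.mem_filter.1 hb).1
    by_contra hne
    have : b ∈ G.erase a := Finset.mem_erase.2 ⟨Ne.symm hne, hbG⟩
    rw [hab] at this
    exact (Finset.mem_erase.1 this).1 rfl
  have hExsub : Ex ⊆ R3 M G := by
    intro B hB
    rw [hEx, Finset.mem_image] at hB
    obtain ⟨a, ha, rfl⟩ := hB
    unfold R3
    rw [Finset.mem_filter, Finset.mem_powerset]
    exact ⟨Finset.erase_subset _ _, (Finset.mem_filter.1 ha).2⟩
  have hExU : Disjoint Ex (UqG M 6 3 G) := by
    rw [Finset.disjoint_left]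
    intro B hB hBU
    rw [hEx, Finset.mem_image] at hB
    obtain ⟨a, -, rfl⟩ := hB
    exact erase_notMem_UqG hr a hBU
  have hGEx : G ∉ Ex := by
    intro h
    rw [hEx, Finset.mem_image] at h
    obtain ⟨a, ha, hGa⟩ := h
    have : a ∈ G.erase a := by rw [hGa]; exact (Finset.mem_filter.1 ha).1
    exact (Finset.mem_erase.1 this).1 rfl
  have hGU : G ∉ UqG M 6 3 G := self_notMem_UqG (hr.trans (by norm_num))
  have hsub : insert G (Ex ∪ UqG M 6 3 G) ⊆ R3 M G :=
    Finset.insert_subset (self_mem_R3 hG) (Finset.union_subset hExsub (UqG_subset_R3 G))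
  have := Finset.card_le_card hsub
  rw [Finset.card_insert_of_notMem (by rw [Finset.mem_union]; tauto), Finset.card_union_of_disjoint hExU,
    hExcard] at this
  omega

end SixThree

end PercRepro
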